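import Summits.QuantumFields.YangMills.Theorems.UnitScaleTiltProp8FlatRowsWholeClosed
import Summits.QuantumFields.YangMills.Theorems.UnitScaleTiltProp8FlatHBBound164
import Summits.QuantumFields.YangMills.Theorems.UnitScaleTiltProp8FlatDomainsCongr
import HarnessLib

/-!
# Route `UnitScaleTilt`, crux K1 child «MinimiserStabilityRegPr» (stmt-QuantumFields-19200), registered stub `stub_halvingStep` (H),
# OWNER RULING g26-№17 (A) branch **H-WHOLE**, twin **(W-i)**: **[Balaban1985Variational] (164) AT THE ONE-TERRITORY FAMILY
# `D := Domains.whole (K − n)` (`Ω_j = T` for every `j ≤ k`), NEAR-ONLY, FOR EVERY ODD `L > 1`, EVERY MEMBER, EVERY `n < K`**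

Cell `ym3-torus` (HUMAN RULING D-0037, YM ladder rung R3 — continuum SU(2) YM₃ on the torus is a RUNG, not the Clay problem), width seat
`ym-ust-20520-w1` gen 5.  `--supports stmt-QuantumFields-19200 --as helper`; def-free, 0 sorry, standard axioms.

THE PRINT ([Balaban1985Variational] p. 303–304): *«Then we get on Δ |HB|, |∇^ηHB|, |∂^{η*}∂^ηHB|, |Δ^ηHB| < ¼M_Δ max{B₃ε₁, ½ε₀}. (164)»* — from
(161) (the decaying kernel of `H`), (162) (the row sum) and the sizes of the datum `B`: NEAR size `O(ε₁·(d + 1))` on the top territory ((160)) and FAR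
size `O(ε₀)` at distance `≥ R₁M₁` below it ((155), (163)).  [Balaban1984PropagatorsII] p. 224: *«we admit the case when some domains Ω_j are equal to
T_η, for example Ω_j = T_η for j = 1, 2, …, l»* — with `l = k` every index bond is a top-level bond (`FlatDomainsCongr.lamBond_whole_iff`), so there
is NO far part of the datum: (164) at `whole` needs (161) + (162) + the near size only — no (163), no `ρ ∕ R₁M₁ ∕ r₀`, no restriction on the bond `b`.

WHAT THIS FILE PROVES (bookkeeping over landed rows; the engine is `FlatHBBound164.rows164_of_hDecayLetterD`, D-generic):
* §1 `bondIdx_level_whole`, `pow_level_whole` (every index bond of `whole (K − n)` sits at level `K − n`; the unit factor `L^{k − j(c)} = 1`),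
  `rowSum162_mono` ((162) is monotone in `B₃`), `rowSum162_const_nonneg` (`0 ≤ B₃` once (162) holds over a dominating distance).
* §2 ★`rows164_near_whole` — for ANY `H` carrying the P2 letters `HDecayLetterD F n K (whole (K−n)) dBI w H B₀ δ₀` and `RowSum162 … dBI w δ₀ B₃` over a
  dominating distance `dBI ≥ distBI`, `0 ≤ δ₀, B₀, C, M_Δ, ε₁`, and a datum with the NEAR size `|X c| ≤ C·M_Δ·ε₁·(distBI b c + 1)` on EVERY index bond:
  the four rows UNWEIGHTED (`w ≡ 1`, `FlatCubeOpsTextWhole.levWeight_whole_eq_one`) `|HX b|, Lᵏ|∇HX b|, |∂^{η*}∂^ηHX b|, L^{2k}|ΔHX b| ≤ B₀·B₃·(C·M_Δ·ε₁)`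
  at EVERY fine bond `b` (sharp form); ★`rows164_quarter_whole` — the same `≤ ¼M_Δ·max{4CB₀B₃ε₁, ½ε₀}` for every `ε₀ ≥ 0` (the cube chain's currency of
  `HalvingQuarterCubeSeq.rows164_quarter_cubeSeqMT3_top`; (163) is not needed: `B₀B₃·CM_Δε₁ = ¼M_Δ·(4CB₀B₃ε₁)`).
* §3 ★★`quarter164_whole (L) (hL : Odd L ∧ 1 < L)` — `FlatRowsWholeClosed.body_whole` ∘ §2: constants `B₀ ≥ 0`, `δ₀ > 0`, `B₃ ≥ 0` depending on `L` only such
  that for every member `F.L = L`, all `n < K`, all P2 weights `w`: the canonical pinned `H`, `G̃` of `whole (K − n)` with the three guarded letters, a dominating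
  `dBI` with (162) and (161)₁, AND (164) in both forms for every near datum at every fine bond — EVERY odd `L > 1` (incl. `L = 3`), no `4 ≤ ℓ`, no `a′`,
  no torus-size numeral (the twin of `HalvingQuarterL5.quarter164_L5` for the H-WHOLE branch).
HONEST SCOPE: the one-territory family is ONE admissible datum; nothing here proves the H stub, the crux, the rung or a mass gap; YM₃ on T³ = rung R3, NOT Clay.

References: T. Bałaban, CMP **102** (1985) 277–309 [Balaban1985Variational] (46) p.285, (160)–(163) p.303, (164) p.304; CMP **96** (1984) 223–250
[Balaban1984PropagatorsII] (2.1)–(2.3) p.224, Cor. 2.8 (2.150)–(2.151) p.249.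
-/

set_option autoImplicit false

noncomputable section

open scoped BigOperators

namespace Summit.QuantumFields.YangMills.Theorems.HalvingQuarterWhole

open Literature.MathematicalPhysics.QuantumFieldTheory.Balaban1983to89
open B6SectADomainsV1 (Domains)
open B6SectAOperatorsV1 (BondIdx dcE dcsE)
open T3ContinuumYM3Torus (T3Family)
open FlatCubeOpsText (distBI IsLevWeight IsFlatH IsFlatGt HSupLetterG GtSupLetterG GtLaplaceLetterG HDecayLetterD RowSum162)
open FlatMinimizerH (le_T3)
open FlatOpsLettersAssembly (hSupLetterG_mono gtSupLetterG_mono gtLaplaceLetterG_mono hDecayLetterD_mono)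
open FlatRowsWholeClosed (body_whole distBI_nonneg')

/-! ## §1 The one-territory family: every index bond is a top bond; (162) bookkeeping -/

section Geometry

variable {F : T3Family} {n K : ℕ}

/-- **every index bond of `whole (K − n)` sits at the top level `K − n`** (`Λ_j = ∅` for `j < k`, `Λ_k = T^{(k)}`). [cite: Balaban1984PropagatorsII, (2.1)-(2.3) p.224] -/
theorem bondIdx_level_whole (c : BondIdx (Domains.whole (K - n) (le_T3 F n K) : Domains (F.P K))) : (c.1.1 : ℕ) = K - n :=
  (FlatDomainsCongr.lamBond_whole_iff (le_T3 F n K) _ _).1 c.2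

/-- at `whole (K − n)` the unit factor `L^{k − j(c)}` of the near/far sizes is `1`. [cite: Balaban1985Variational, (160)-(161) p.303] -/
theorem pow_level_whole (c : BondIdx (Domains.whole (K - n) (le_T3 F n K) : Domains (F.P K))) :
    (F.L : ℝ) ^ ((K - n) - (c.1.1 : ℕ)) = 1 := by
  rw [bondIdx_level_whole c, Nat.sub_self, pow_zero]

variable {D : Domains (F.P K)}

/-- (162) is monotone in `B₃`. [cite: Balaban1985Variational, (162) p.303] -/
theorem rowSum162_mono {dBI : PBond (F.P K) 0 → BondIdx D → ℝ} {w : ℕ → PBond (F.P K) 0 → ℝ} {δ₀ B₃ B₃' : ℝ}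
    (h : RowSum162 F n K D dBI w δ₀ B₃) (hBB' : B₃ ≤ B₃') : RowSum162 F n K D dBI w δ₀ B₃' :=
  fun b => (h b).trans hBB'

/-- once (162) holds over a dominating distance (`dBI ≥ distBI ≥ 0`) with nonnegative level weights, its constant is `≥ 0` (read at any fine bond).
[cite: Balaban1985Variational, (162) p.303] -/
theorem rowSum162_const_nonneg {dBI : PBond (F.P K) 0 → BondIdx D → ℝ} {w : ℕ → PBond (F.P K) 0 → ℝ} {δ₀ B₃ : ℝ}
    (h : RowSum162 F n K D dBI w δ₀ B₃) (hw : IsLevWeight F n K D w) (hdom : ∀ b c, distBI D b c ≤ dBI b c) (b : PBond (F.P K) 0) : 0 ≤ B₃ := by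
  refine le_trans (mul_nonneg (FlatOpsLettersAssembly.levWeight_nonneg hw 1 b) (Finset.sum_nonneg fun c _ => ?_)) (h b)
  have hd : 0 ≤ dBI b c := (distBI_nonneg' D b c).trans (hdom b c)
  exact mul_nonneg (mul_nonneg (Real.exp_pos _).le (by linarith)) (pow_nonneg (Nat.cast_nonneg _) _)

end Geometry

/-! ## §2 (164) at `whole (K − n)`, modulo the letters: near-only, every fine bond -/

section Rows

variable {F : T3Family} {n K : ℕ}

/-- **(164) AT THE ONE-TERRITORY FAMILY, SHARP FORM, MODULO THE LETTERS**: for any `H` with (161)₁ `HDecayLetterD` and (162) `RowSum162` at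
`D := whole (K − n)` over a dominating distance `dBI ≥ distBI`, and a datum of NEAR size `|X(c)| ≤ C·M_Δ·ε₁·(distBI(b,c) + 1)` on every index bond, the four
rows at the fine bond `b` — `|HX(b)|`, `Lᵏ|∇HX(b)|`, `|∂^{η*}∂^ηHX(b)|`, `L^{2k}|ΔHX(b)|` (weights `= 1`) — are `≤ B₀·B₃·(C·M_Δ·ε₁)`.
[cite: Balaban1985Variational, (160)-(162) p.303, (164) p.304] -/
theorem rows164_near_whole {dBI : PBond (F.P K) 0 → BondIdx (Domains.whole (K - n) (le_T3 F n K) : Domains (F.P K)) → ℝ}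
    {w : ℕ → PBond (F.P K) 0 → ℝ}
    {H : (BondIdx (Domains.whole (K - n) (le_T3 F n K) : Domains (F.P K)) → ℝ) →ₗ[ℝ] (PBond (F.P K) 0 → ℝ)} {δ₀ B₀ B₃ C MΔ ε₁ : ℝ}
    (hw : IsLevWeight F n K (Domains.whole (K - n) (le_T3 F n K)) w)
    (hdom : ∀ b c, distBI (Domains.whole (K - n) (le_T3 F n K) : Domains (F.P K)) b c ≤ dBI b c)
    (hH : HDecayLetterD F n K (Domains.whole (K - n) (le_T3 F n K)) dBI w H B₀ δ₀)
    (h162 : RowSum162 F n K (Domains.whole (K - n) (le_T3 F n K)) dBI w δ₀ B₃)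
    (hδ₀ : 0 ≤ δ₀) (hB₀ : 0 ≤ B₀) (hC : 0 ≤ C) (hMΔ : 0 ≤ MΔ) (hε₁ : 0 ≤ ε₁)
    {X : BondIdx (Domains.whole (K - n) (le_T3 F n K) : Domains (F.P K)) → ℝ} {b : PBond (F.P K) 0}
    (hnear : ∀ c, |X c| ≤ C * MΔ * ε₁ * (distBI (Domains.whole (K - n) (le_T3 F n K) : Domains (F.P K)) b c + 1)) :
    |H X b| ≤ B₀ * B₃ * (C * MΔ * ε₁) ∧
    (∀ ν : Fin 3, (F.L : ℝ) ^ (K - n) * |H X ⟨b.src.shift ν, b.dir⟩ - H X b| ≤ B₀ * B₃ * (C * MΔ * ε₁)) ∧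
    |(dcsE ((F.L : ℝ) ^ (K - n)) (dcE ((F.L : ℝ) ^ (K - n)) (WithLp.toLp 2 (H X)))) b| ≤ B₀ * B₃ * (C * MΔ * ε₁) ∧
    ((F.L : ℝ) ^ (K - n)) ^ 2 * |∑ ν : Fin 3, ((H X b - H X ⟨b.src.shift ν, b.dir⟩) + (H X b - H X ⟨b.src.unshift ν, b.dir⟩))| ≤
      B₀ * B₃ * (C * MΔ * ε₁) := by
  have h1 : ∀ m, w m b = 1 := fun m => FlatCubeOpsTextWhole.levWeight_whole_eq_one F n K (le_T3 F n K) w hw m b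
  have hCMε₁ : 0 ≤ C * MΔ * ε₁ := by positivity
  -- the effective datum: near size on every index bond, `e^{−½δ₀d} ≤ 1`, `L^{k − j(c)} = 1`, `distBI ≤ dBI`
  have hX : ∀ c, Real.exp (-(δ₀ / 2 * dBI b c)) * |X c| ≤ (C * MΔ * ε₁) * ((dBI b c + 1) * (F.L : ℝ) ^ ((K - n) - (c.1.1 : ℕ))) := by
    intro c
    have hd : 0 ≤ dBI b c := (distBI_nonneg' _ b c).trans (hdom b c)
    have hexp : Real.exp (-(δ₀ / 2 * dBI b c)) ≤ 1 := Real.exp_le_one_iff.2 (neg_nonpos.2 (mul_nonneg (by linarith) hd))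
    rw [pow_level_whole c, mul_one]
    calc Real.exp (-(δ₀ / 2 * dBI b c)) * |X c| ≤ 1 * |X c| := mul_le_mul_of_nonneg_right hexp (abs_nonneg _)
      _ = |X c| := one_mul _
      _ ≤ C * MΔ * ε₁ * (distBI (Domains.whole (K - n) (le_T3 F n K) : Domains (F.P K)) b c + 1) := hnear c
      _ ≤ C * MΔ * ε₁ * (dBI b c + 1) := mul_le_mul_of_nonneg_left (by linarith [hdom b c]) hCMε₁
  obtain ⟨r1, r2, r3, r4⟩ := FlatHBBound164.rows164_of_hDecayLetterD hH h162 hB₀ hCMε₁ (by rw [h1 1]; exact zero_le_one) hX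
  rw [h1 1] at r1 r2 r3 r4
  rw [h1 2] at r2
  rw [h1 3] at r3 r4
  exact ⟨by simpa using r1, fun ν => by simpa using r2 ν, by simpa using r3, by simpa using r4⟩

/-- **(164) AT THE ONE-TERRITORY FAMILY IN THE CUBE CHAIN'S CURRENCY, MODULO THE LETTERS**: under the hypotheses of `rows164_near_whole` and for every
`ε₀ ≥ 0`, the four rows at `b` are `≤ ¼M_Δ·max{4CB₀B₃ε₁, ½ε₀}` (print's (164) with `B₃ ↦ 4CB₀B₃`; no (163) needed since there is no far datum).
[cite: Balaban1985Variational, (164) p.304] -/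
theorem rows164_quarter_whole {dBI : PBond (F.P K) 0 → BondIdx (Domains.whole (K - n) (le_T3 F n K) : Domains (F.P K)) → ℝ}
    {w : ℕ → PBond (F.P K) 0 → ℝ}
    {H : (BondIdx (Domains.whole (K - n) (le_T3 F n K) : Domains (F.P K)) → ℝ) →ₗ[ℝ] (PBond (F.P K) 0 → ℝ)} {δ₀ B₀ B₃ C MΔ ε₁ : ℝ}
    (hw : IsLevWeight F n K (Domains.whole (K - n) (le_T3 F n K)) w)
    (hdom : ∀ b c, distBI (Domains.whole (K - n) (le_T3 F n K) : Domains (F.P K)) b c ≤ dBI b c)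
    (hH : HDecayLetterD F n K (Domains.whole (K - n) (le_T3 F n K)) dBI w H B₀ δ₀)
    (h162 : RowSum162 F n K (Domains.whole (K - n) (le_T3 F n K)) dBI w δ₀ B₃)
    (hδ₀ : 0 ≤ δ₀) (hB₀ : 0 ≤ B₀) (hC : 0 ≤ C) (hMΔ : 0 ≤ MΔ) (hε₁ : 0 ≤ ε₁) (ε₀ : ℝ)
    {X : BondIdx (Domains.whole (K - n) (le_T3 F n K) : Domains (F.P K)) → ℝ} {b : PBond (F.P K) 0}
    (hnear : ∀ c, |X c| ≤ C * MΔ * ε₁ * (distBI (Domains.whole (K - n) (le_T3 F n K) : Domains (F.P K)) b c + 1)) :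
    |H X b| ≤ 1 / 4 * MΔ * max (4 * C * B₀ * B₃ * ε₁) (ε₀ / 2) ∧
    (∀ ν : Fin 3, (F.L : ℝ) ^ (K - n) * |H X ⟨b.src.shift ν, b.dir⟩ - H X b| ≤ 1 / 4 * MΔ * max (4 * C * B₀ * B₃ * ε₁) (ε₀ / 2)) ∧
    |(dcsE ((F.L : ℝ) ^ (K - n)) (dcE ((F.L : ℝ) ^ (K - n)) (WithLp.toLp 2 (H X)))) b| ≤ 1 / 4 * MΔ * max (4 * C * B₀ * B₃ * ε₁) (ε₀ / 2) ∧
    ((F.L : ℝ) ^ (K - n)) ^ 2 * |∑ ν : Fin 3, ((H X b - H X ⟨b.src.shift ν, b.dir⟩) + (H X b - H X ⟨b.src.unshift ν, b.dir⟩))| ≤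
      1 / 4 * MΔ * max (4 * C * B₀ * B₃ * ε₁) (ε₀ / 2) := by
  have hq : B₀ * B₃ * (C * MΔ * ε₁) ≤ 1 / 4 * MΔ * max (4 * C * B₀ * B₃ * ε₁) (ε₀ / 2) := by
    calc B₀ * B₃ * (C * MΔ * ε₁) = 1 / 4 * MΔ * (4 * C * B₀ * B₃ * ε₁) := by ring
      _ ≤ 1 / 4 * MΔ * max (4 * C * B₀ * B₃ * ε₁) (ε₀ / 2) := mul_le_mul_of_nonneg_left (le_max_left _ _) (by positivity)
  obtain ⟨r1, r2, r3, r4⟩ := rows164_near_whole hw hdom hH h162 hδ₀ hB₀ hC hMΔ hε₁ hnear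
  exact ⟨r1.trans hq, fun ν => (r2 ν).trans hq, r3.trans hq, r4.trans hq⟩

end Rows

/-! ## §3 The by-name junction with `FlatRowsWholeClosed.body_whole`: (164) at `whole`, every odd `L > 1` -/

/-- **(164) AT THE ONE-TERRITORY FAMILY, UNCONDITIONALLY, EVERY ODD `L > 1`, EVERY MEMBER, EVERY `n < K`** (`FlatRowsWholeClosed.body_whole` + §2): constants
`B₀ ≥ 0`, `δ₀ > 0`, `B₃ ≥ 0` depending on `L` only; for every member `F.L = L`, heights `n < K` and P2 level weights `w` of `D := whole (K − n)` THERE ARE the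
canonical pinned `H`, `G̃` (`IsFlatH`/`IsFlatGt`) with the guarded letters `HSupLetterG`/`GtSupLetterG`/`GtLaplaceLetterG`, a dominating distance `dBI` with
(162) `RowSum162` and (161)₁ `HDecayLetterD`, AND for all `C, M_Δ, ε₁, ε₀ ≥ 0`, every datum `X` of near size `|X c| ≤ C·M_Δ·ε₁·(distBI b c + 1)` and every fine
bond `b`: (164) `|HX b|, Lᵏ|∇HX b|, |∂^{η*}∂^ηHX b|, L^{2k}|ΔHX b| ≤ ¼M_Δ·max{4CB₀B₃ε₁, ½ε₀}`.  No `4 ≤ ℓ`, no `a′`, no torus-size numeral, no (163).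
[cite: Balaban1985Variational, (46) p.285, (160)-(163) p.303, (164) p.304; Balaban1984PropagatorsII, (2.1)-(2.3) p.224, Cor. 2.8 (2.150)-(2.151) p.249] -/
theorem quarter164_whole (L : ℕ) (hL : Odd L ∧ 1 < L) :
    ∃ (B₀ δ₀ B₃ : ℝ), 0 ≤ B₀ ∧ 0 < δ₀ ∧ 0 ≤ B₃ ∧ ∀ (F : T3Family), F.L = L → ∀ (n K : ℕ), n < K →
      ∀ (w : ℕ → PBond (F.P K) 0 → ℝ), IsLevWeight F n K (Domains.whole (K - n) (le_T3 F n K)) w →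
      ∃ (H : (BondIdx (Domains.whole (K - n) (le_T3 F n K) : Domains (F.P K)) → ℝ) →ₗ[ℝ] (PBond (F.P K) 0 → ℝ))
        (Gt : (PBond (F.P K) 0 → ℝ) →ₗ[ℝ] (PBond (F.P K) 0 → ℝ)),
        IsFlatH F n K (Domains.whole (K - n) (le_T3 F n K)) H ∧ IsFlatGt F n K (Domains.whole (K - n) (le_T3 F n K)) Gt ∧
        HSupLetterG F n K (Domains.whole (K - n) (le_T3 F n K)) w H B₀ ∧ GtSupLetterG F n K w Gt B₀ ∧ GtLaplaceLetterG F n K w Gt B₀ ∧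
        (∃ dBI : PBond (F.P K) 0 → BondIdx (Domains.whole (K - n) (le_T3 F n K) : Domains (F.P K)) → ℝ,
          (∀ b c, distBI (Domains.whole (K - n) (le_T3 F n K)) b c ≤ dBI b c) ∧ RowSum162 F n K (Domains.whole (K - n) (le_T3 F n K)) dBI w δ₀ B₃ ∧
            HDecayLetterD F n K (Domains.whole (K - n) (le_T3 F n K)) dBI w H B₀ δ₀) ∧
        ∀ (C MΔ ε₁ ε₀ : ℝ), 0 ≤ C → 0 ≤ MΔ → 0 ≤ ε₁ → 0 ≤ ε₀ →
          ∀ (X : BondIdx (Domains.whole (K - n) (le_T3 F n K) : Domains (F.P K)) → ℝ) (b : PBond (F.P K) 0),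
            (∀ c, |X c| ≤ C * MΔ * ε₁ * (distBI (Domains.whole (K - n) (le_T3 F n K) : Domains (F.P K)) b c + 1)) →
            |H X b| ≤ 1 / 4 * MΔ * max (4 * C * B₀ * B₃ * ε₁) (ε₀ / 2) ∧
            (∀ ν : Fin 3, (F.L : ℝ) ^ (K - n) * |H X ⟨b.src.shift ν, b.dir⟩ - H X b| ≤ 1 / 4 * MΔ * max (4 * C * B₀ * B₃ * ε₁) (ε₀ / 2)) ∧
            |(dcsE ((F.L : ℝ) ^ (K - n)) (dcE ((F.L : ℝ) ^ (K - n)) (WithLp.toLp 2 (H X)))) b| ≤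
              1 / 4 * MΔ * max (4 * C * B₀ * B₃ * ε₁) (ε₀ / 2) ∧
            ((F.L : ℝ) ^ (K - n)) ^ 2 * |∑ ν : Fin 3, ((H X b - H X ⟨b.src.shift ν, b.dir⟩) + (H X b - H X ⟨b.src.unshift ν, b.dir⟩))| ≤
              1 / 4 * MΔ * max (4 * C * B₀ * B₃ * ε₁) (ε₀ / 2) := by
  obtain ⟨B₀, δ₀, B₃, hδ₀, hmain⟩ := body_whole L hL
  -- export `max B₀ 0`, `max B₃ 0`: every letter is monotone in its constant
  refine ⟨max B₀ 0, δ₀, max B₃ 0, le_max_right _ _, hδ₀, le_max_right _ _, fun F hF n K hnK w hw => ?_⟩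
  obtain ⟨H, Gt, hFH, hFG, hHs, hGs, hGl, dBI, hdom, h162, hHd⟩ := hmain F hF n K hnK w hw
  have hHd' : HDecayLetterD F n K (Domains.whole (K - n) (le_T3 F n K)) dBI w H (max B₀ 0) δ₀ := hDecayLetterD_mono hHd (le_max_left _ _)
  have h162' : RowSum162 F n K (Domains.whole (K - n) (le_T3 F n K)) dBI w δ₀ (max B₃ 0) := rowSum162_mono h162 (le_max_left _ _)
  refine ⟨H, Gt, hFH, hFG, hSupLetterG_mono hHs (le_max_left _ _), gtSupLetterG_mono hGs (le_max_left _ _),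
    gtLaplaceLetterG_mono hGl (le_max_left _ _), ⟨dBI, hdom, h162', hHd'⟩, ?_⟩
  intro C MΔ ε₁ ε₀ hC hMΔ hε₁ _hε₀ X b hnear
  exact rows164_quarter_whole hw hdom hHd' h162' hδ₀.le (le_max_right _ _) hC hMΔ hε₁ ε₀ hnear

end Summit.QuantumFields.YangMills.Theorems.HalvingQuarterWhole

end
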